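import Mathlib
import Summits.Ventures.HodgeRepro.PeriodCloserC7Stability
import Summits.Ventures.HodgeRepro.OcticCMPointS3

/-!
# OcticCMPointInertModel — the residue field `𝔽₁₆` at the inert place `𝔮 | 2` of the octic point, transcribed

Blind re-derivation cell `pub-hodge-repro`, seat night-2 (gen 4).  Target tree path
`lean/Summits/Ventures/HodgeRepro/OcticCMPointInertModel.lean`.  The third place of `S₃` of
`E = ℚ(ζ₅, √(4+√5))` (`OcticCMPointS3.lean`: `octic_q = ⟨2, 1, 2, 4, 16⟩`): `K_v/k_v` unramified quadratic with
residue fields `𝔽₁₆/𝔽₄`, so at conductor `1` the model ring `𝒪/𝔮` is `𝔽₁₆` — Mathlib's `GaloisField 2 4` —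
and the conjugation is the relative Frobenius `x ↦ x⁴` (`conj`, the square of the absolute Frobenius, a
`ZMod 2`-algebra automorphism).  Gen 3's `OcticCMPointTameSign.lean` (`sign_q`, `gauss_mul_gauss_inv_q`) and
`OcticCMPointConjDual.lean` (`conjDual_inert`) take the ring with `|R| = 16`, the conjugation and an additive
character with `ψ ∘ σ = ψ ∘ (−1 ·)` as hypotheses; here they are theorems of `𝔽₁₆`:

* `card_galoisField_two_four`: `|𝔽₁₆| = 16 = octic_q.qK`;
* `conj`: the conjugation `x ↦ x⁴` as a ring automorphism (`conj_apply`), of order `2` (`conj_conj`);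
* `psiTilde ψ₀ = ψ₀ ∘ Tr_{𝔽₁₆/𝔽₂}`: PRIMITIVE for `ψ₀` the non-trivial character of `𝔽₂` (the trace form is
  non-degenerate, Mathlib `FiniteField.trace_to_zmod_nondegenerate`), and **Frobenius-invariant**:
  `ψ̃(σ x) = ψ̃(x) = ψ̃(−x)` (`psiTilde_conj`; in characteristic `2`, `−x = x`) — the hypothesis `hψ` of
  `conjDual_inert`.  Every additive character of `𝔽₁₆` is `x ↦ ψ̃(β x)`; the conjugation-compatible ones are
  exactly those with `β ∈ 𝔽₄` (not needed here: `hψ` is already supplied by `β = 1`).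

**What this is not.**  Conductors `c ≥ 2` at `𝔮` (the Galois rings `GR(2^c, 4)`, not `𝔽₂`-algebras) are not
transcribed; the `2`-power-order twist of the route at `𝔮` lives there.  Nothing here says anything about the
status of the Hodge conjecture for CM abelian varieties, which is NOT proved.
-/

set_option autoImplicit false

noncomputable section

open Finset

namespace Summit.Ventures.HodgeRepro.PeriodCloser

namespace InertModel

/-- **The residue field `𝔽₁₆` at `𝔮 | 2`.** -/
abbrev F16 : Type := GaloisField 2 4

/-- `𝔽₁₆` is a finite type. -/
instance instFintypeF16 : Fintype F16 := Fintype.ofFinite _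

/-- `|𝔽₁₆| = 16 = octic_q.qK`. -/
theorem card_galoisField_two_four : Fintype.card F16 = octic_q.qK := by
  rw [← Nat.card_eq_fintype_card, GaloisField.card 2 4 (by norm_num)]
  rfl

/-- `2` is prime. -/
instance fact_prime_two : Fact (Nat.Prime 2) := ⟨Nat.prime_two⟩

/-- `𝔽₁₆` has characteristic `2`. -/
instance instCharP : CharP F16 2 := inferInstance

/-- `x + x = 0` in `𝔽₁₆`. -/
theorem add_self_eq_zero (x : F16) : x + x = 0 := CharTwo.add_self_eq_zero x

/-- `−x = x` in `𝔽₁₆`. -/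
theorem neg_eq (x : F16) : -x = x := CharTwo.neg_eq x

/-! ### The conjugation: the relative Frobenius `x ↦ x⁴` of `𝔽₁₆/𝔽₄` -/

/-- The absolute Frobenius `x ↦ x²` as a `ZMod 2`-algebra automorphism. -/
abbrev frob : F16 ≃ₐ[ZMod 2] F16 := FiniteField.frobeniusAlgEquivOfAlgebraic (ZMod 2) F16

/-- `frob x = x²`. -/
theorem frob_apply (x : F16) : frob x = x ^ 2 := by
  change (x ^ Fintype.card (ZMod 2)) = x ^ 2
  rw [ZMod.card]

/-- **The conjugation** of `K_v/k_v` at `𝔮 | 2` on the residue field: the relative Frobenius `x ↦ x⁴` of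
`𝔽₁₆/𝔽₄`, as a `ZMod 2`-algebra automorphism (`frob ∘ frob`). -/
abbrev conjAlg : F16 ≃ₐ[ZMod 2] F16 := frob.trans frob

/-- **The conjugation** as a ring automorphism. -/
abbrev conj : F16 ≃+* F16 := conjAlg.toRingEquiv

/-- `σ x = x⁴`. -/
theorem conj_apply (x : F16) : conj x = x ^ 4 := by
  change frob (frob x) = x ^ 4
  rw [frob_apply, frob_apply, ← pow_mul]

/-- `x¹⁶ = x` in `𝔽₁₆`. -/
theorem pow_sixteen (x : F16) : x ^ 16 = x := by
  have h := FiniteField.pow_card x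
  rwa [card_galoisField_two_four] at h

/-- `σ² = id`: the conjugation has order `2` (`x¹⁶ = x`). -/
theorem conj_conj (x : F16) : conj (conj x) = x := by
  rw [conj_apply, conj_apply, ← pow_mul, pow_sixteen]

/-! ### The additive character `ψ̃ = ψ₀ ∘ Tr` -/

/-- The absolute trace `𝔽₁₆ → 𝔽₂` as an additive homomorphism. -/
abbrev tr : F16 →+ ZMod 2 := (Algebra.trace (ZMod 2) F16).toAddMonoidHom

/-- **The induced additive character** `ψ̃ = ψ₀ ∘ Tr_{𝔽₁₆/𝔽₂}` for a character `ψ₀` of `𝔽₂`. -/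
def psiTilde (ψ₀ : AddChar (ZMod 2) ℂ) : AddChar F16 ℂ := ψ₀.compAddMonoidHom tr

/-- `ψ̃(x) = ψ₀(Tr x)`. -/
theorem psiTilde_apply (ψ₀ : AddChar (ZMod 2) ℂ) (x : F16) :
    psiTilde ψ₀ x = ψ₀ (Algebra.trace (ZMod 2) F16 x) := rfl

/-- **`ψ̃` is primitive when `ψ₀` is non-trivial on `𝔽₂`** (`ψ₀ 1 ≠ 1`): the trace form of `𝔽₁₆/𝔽₂` is
non-degenerate, so for `a ≠ 0` some `b` has `Tr(a b) = 1`. -/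
theorem psiTilde_isPrimitive (ψ₀ : AddChar (ZMod 2) ℂ) (h₀ : ψ₀ 1 ≠ 1) : (psiTilde ψ₀).IsPrimitive := by
  intro a ha h1
  -- non-degeneracy of the trace form of `𝔽₁₆/𝔽₂`
  have htr := (traceForm_nondegenerate (ZMod 2) F16).1 a
  simp_rw [Algebra.traceForm_apply] at htr
  have hex : ∃ b, Algebra.trace (ZMod 2) F16 (a * b) ≠ 0 := by
    by_contra! hf
    exact ha (htr hf)
  obtain ⟨b, hb⟩ := hex
  have key := DFunLike.congr_fun h1 b
  rw [AddChar.mulShift_apply, AddChar.one_apply, psiTilde_apply] at key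
  apply h₀
  have h2 : ∀ t : ZMod 2, t ≠ 0 → t = 1 := by decide
  rwa [h2 _ hb] at key

/-- **Frobenius invariance**: `ψ̃(σ x) = ψ̃(x)` (`Algebra.trace_eq_of_algEquiv`). -/
theorem psiTilde_conj (ψ₀ : AddChar (ZMod 2) ℂ) (x : F16) : psiTilde ψ₀ (conj x) = psiTilde ψ₀ x := by
  rw [psiTilde_apply, psiTilde_apply]
  congr 1
  exact Algebra.trace_eq_of_algEquiv conjAlg x

/-- **The hypothesis `hψ` of `conjDual_inert`** (`OcticCMPointConjDual.lean`): `ψ̃(σ x) = ψ̃(−x)` — in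
characteristic `2`, `−x = x`. -/
theorem psiTilde_conj_neg (ψ₀ : AddChar (ZMod 2) ℂ) (x : F16) : psiTilde ψ₀ (conj x) = psiTilde ψ₀ (-x) := by
  rw [psiTilde_conj, neg_eq]

/-- **The non-trivial character of `𝔽₂`**: `ψ₀ = (−1)^x` (Mathlib's `AddChar.zmodChar`). -/
def psi0 : AddChar (ZMod 2) ℂ := AddChar.zmodChar 2 (by norm_num : (-1 : ℂ) ^ 2 = 1)

/-- `ψ₀(1) = −1 ≠ 1`. -/
theorem psi0_one_ne_one : psi0 1 ≠ 1 := by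
  rw [psi0, AddChar.zmodChar_apply, ZMod.val_one, pow_one]
  norm_num

/-- **The primitive Frobenius-invariant character of `𝔽₁₆` exists**: `ψ̃ = (−1)^{Tr x}`. -/
theorem psiTilde_psi0_isPrimitive : (psiTilde psi0).IsPrimitive := psiTilde_isPrimitive psi0 psi0_one_ne_one

/-! ### The conjugation-compatible additive characters: `ψ̃(β ·)` with `β ∈ 𝔽₄` -/

/-- `σ` is an involution, so `σ x = y ↔ x = σ y`. -/
theorem conj_eq_iff (x y : F16) : conj x = y ↔ x = conj y := by
  constructor
  · rintro rfl; exact (conj_conj x).symm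
  · rintro rfl; exact conj_conj y

/-- **Which shifts of `ψ̃` are conjugation-compatible**: for a primitive `ψ̃` (`ψ₀ 1 ≠ 1`),
`ψ̃(β σ x) = ψ̃(β x)` for all `x` iff `β⁴ = β`, i.e. iff `β ∈ 𝔽₄` — so the additive characters of `𝔽₁₆`
satisfying the hypothesis of `conjDual_inert` are exactly the `𝔽₄`-multiples of `ψ̃`. -/
theorem mulShift_conj_iff (ψ₀ : AddChar (ZMod 2) ℂ) (h₀ : ψ₀ 1 ≠ 1) (β : F16) :
    (∀ x, AddChar.mulShift (psiTilde ψ₀) β (conj x) = AddChar.mulShift (psiTilde ψ₀) β x) ↔ β ^ 4 = β := by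
  have hprim := psiTilde_isPrimitive ψ₀ h₀
  constructor
  · intro h
    by_contra hne
    -- `ψ̃(β σ x) = ψ̃(σ(σβ · x)) = ψ̃(σβ · x)` (Frobenius invariance), so `ψ̃((σβ − β) x) = 1` for all `x`
    have key : ∀ x, psiTilde ψ₀ ((conj β - β) * x) = 1 := by
      intro x
      have h1 := h (conj x)
      rw [conj_conj, AddChar.mulShift_apply, AddChar.mulShift_apply] at h1
      have h2 : psiTilde ψ₀ (β * conj x) = psiTilde ψ₀ (conj β * x) := by
        rw [← psiTilde_conj ψ₀ (conj β * x), map_mul conj (conj β) x, conj_conj]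
      have hne0 : psiTilde ψ₀ (β * x) ≠ 0 := by
        have : psiTilde ψ₀ (β * x) * psiTilde ψ₀ (-(β * x)) = 1 := by
          rw [← AddChar.map_add_eq_mul, add_neg_cancel, AddChar.map_zero_eq_one]
        exact left_ne_zero_of_mul_eq_one this
      have h3 : psiTilde ψ₀ ((conj β - β) * x) * psiTilde ψ₀ (β * x) = psiTilde ψ₀ (β * x) := by
        rw [← AddChar.map_add_eq_mul, show (conj β - β) * x + β * x = conj β * x by ring, ← h2, ← h1]
      exact (mul_left_eq_self₀.1 h3).resolve_right hne0
    apply hprim (sub_ne_zero.2 (fun h' => hne (by rw [← conj_apply]; exact h')))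
    ext x
    rw [AddChar.mulShift_apply, AddChar.one_apply]
    exact key x
  · intro h x
    rw [AddChar.mulShift_apply, AddChar.mulShift_apply]
    conv_rhs => rw [← psiTilde_conj ψ₀ (β * x)]
    rw [map_mul conj β x, conj_apply β, h]

/-! ### The conjugate-dual tame characters at `𝔮`: order dividing `5` -/

/-- **Conjugate duality on `𝔽₁₆^×` means order dividing `5`** (`q_k + 1 = 5`, gen 3's `tame_dual_q`):
`ω(x⁴) = ω(x)⁻¹` for all `x` iff `ω(x)⁵ = 1` for all `x ≠ 0` — at the inert place the tame conjugate-dual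
characters are exactly the characters of `𝔽₁₆^×` of order dividing `5` (automatically trivial on `𝔽₄^×`, which
has order `3`: the unramified `ω_{K_v/k_v}` is trivial on the units). -/
theorem conjDual_iff_pow_five (ω : MulChar F16 ℂ) :
    (∀ x, ω (conj x) = ω⁻¹ x) ↔ ∀ x, x ≠ 0 → ω x ^ 5 = 1 := by
  constructor
  · intro h x hx
    have h1 := h x
    rw [conj_apply, map_pow, MulChar.inv_apply_eq_inv'] at h1
    have hne : ω x ≠ 0 := by
      intro h0
      have hu : IsUnit x := isUnit_iff_ne_zero.2 hx
      have h2 : ω x * ω x⁻¹ = 1 := by rw [← map_mul, mul_inv_cancel₀ hx, MulChar.map_one]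
      rw [h0, zero_mul] at h2
      exact zero_ne_one h2
    rw [pow_succ, h1, inv_mul_cancel₀ hne]
  · intro h x
    rw [conj_apply, map_pow, MulChar.inv_apply_eq_inv']
    by_cases hx : x = 0
    · subst hx
      rw [MulChar.map_zero, zero_pow (by norm_num), inv_zero]
    · have hne : ω x ≠ 0 := by
        intro h0
        have := h x hx
        rw [h0, zero_pow (by norm_num)] at this
        exact zero_ne_one this
      have h5 := h x hx
      rw [pow_succ] at h5
      exact eq_inv_of_mul_eq_one_left h5

/-! ### The Gauss sums at `𝔮` in closed form: `𝔤(ω) = ±4` for a conjugate-dual tame `ω` -/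

/-- In characteristic `2`, `ψ̃⁻¹ = ψ̃` (`ψ̃⁻¹(x) = ψ̃(−x) = ψ̃(x)`). -/
theorem psiTilde_inv (ψ₀ : AddChar (ZMod 2) ℂ) : (psiTilde ψ₀)⁻¹ = psiTilde ψ₀ := by
  ext x
  rw [AddChar.inv_apply, neg_eq]

/-- **`𝔤(ω⁻¹, ψ̃) = 𝔤(ω, ψ̃)` for a conjugate-dual `ω`**: reindex the sum by `σ` and use the Frobenius
invariance of `ψ̃`. -/
theorem gaussSum_inv_eq_of_conjDual (ψ₀ : AddChar (ZMod 2) ℂ) (ω : MulChar F16 ℂ)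
    (hσ : ∀ x, ω (conj x) = ω⁻¹ x) : gaussSum ω⁻¹ (psiTilde ψ₀) = gaussSum ω (psiTilde ψ₀) := by
  unfold gaussSum
  refine (Fintype.sum_equiv conj.toEquiv _ _ fun x => ?_).symm
  change ω x * psiTilde ψ₀ x = ω⁻¹ (conj x) * psiTilde ψ₀ (conj x)
  rw [psiTilde_conj, ← hσ, conj_conj]

/-- **`𝔤(ω, ψ̃)² = 16` for a non-trivial conjugate-dual tame `ω` at `𝔮 | 2`** (Mathlib
`gaussSum_mul_gaussSum_eq_card` with `ψ̃⁻¹ = ψ̃` and `𝔤(ω⁻¹) = 𝔤(ω)`). -/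
theorem gaussSum_sq_eq_sixteen (ψ₀ : AddChar (ZMod 2) ℂ) (h₀ : ψ₀ 1 ≠ 1) (ω : MulChar F16 ℂ) (hω : ω ≠ 1)
    (hσ : ∀ x, ω (conj x) = ω⁻¹ x) : gaussSum ω (psiTilde ψ₀) ^ 2 = 16 := by
  have h := gaussSum_mul_gaussSum_eq_card hω (psiTilde_isPrimitive ψ₀ h₀)
  rw [psiTilde_inv, gaussSum_inv_eq_of_conjDual ψ₀ ω hσ, ← sq, card_galoisField_two_four] at h
  rw [h]
  rfl

/-- **`𝔤(ω, ψ̃) = ±4`** for a non-trivial conjugate-dual tame `ω` at `𝔮 | 2`. -/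
theorem gaussSum_eq_four_or_neg_four (ψ₀ : AddChar (ZMod 2) ℂ) (h₀ : ψ₀ 1 ≠ 1) (ω : MulChar F16 ℂ) (hω : ω ≠ 1)
    (hσ : ∀ x, ω (conj x) = ω⁻¹ x) : gaussSum ω (psiTilde ψ₀) = 4 ∨ gaussSum ω (psiTilde ψ₀) = -4 := by
  have h := gaussSum_sq_eq_sixteen ψ₀ h₀ ω hω hσ
  have h' : gaussSum ω (psiTilde ψ₀) ^ 2 = (4 : ℂ) ^ 2 := by rw [h]; norm_num
  exact sq_eq_sq_iff_eq_or_eq_neg.1 h'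

/-- **The conductor-`1` root number at `𝔮 | 2` in closed form**: for a non-trivial conjugate-dual tame `ω`
(`ω ∘ σ = ω⁻¹`, order dividing `5`) and the `s = ½` constant `κ = ¼` (`|𝔽₁₆|^{−1/2}`), Kudla's
`ε = ω(ϖ)^n · κ · 𝔤(ω⁻¹, ψ̃)` is `± ω(ϖ)^n` — with NO hypothesis on `ω(ϖ)` (compare `eps_sign_inert`, which
needs `ω(ϖ)² = 1` and gen 3's oleans). -/
theorem eps_eq_pm_piVal_pow (ψ₀ : AddChar (ZMod 2) ℂ) (h₀ : ψ₀ 1 ≠ 1) (n : ℕ) (ω : LocalChar F16)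
    (hω : ω.unit ≠ 1) (hσ : ∀ x, ω.unit (conj x) = ω.unit⁻¹ x) :
    LocalChar.eps (1 / 4) n ω (psiTilde ψ₀) = ω.piVal ^ n ∨
      LocalChar.eps (1 / 4) n ω (psiTilde ψ₀) = -ω.piVal ^ n := by
  unfold LocalChar.eps LocalChar.gauss
  rw [gaussSum_inv_eq_of_conjDual ψ₀ ω.unit hσ]
  rcases gaussSum_eq_four_or_neg_four ψ₀ h₀ ω.unit hω hσ with h | h
  · left; rw [h]; ring
  · right; rw [h]; ring

/-! ### The Gauss sums of the order-`5` characters coincide (Frobenius), so (E3) at `𝔮` is the `ϖ`-part of N2 -/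

/-- **Frobenius invariance of the Gauss sum**: `𝔤(ω², ψ̃) = 𝔤(ω, ψ̃)` for every `ω` (substitute `x = y²`, a
bijection of `𝔽₁₆`, and use `ψ̃(y²) = ψ̃(y)`). -/
theorem gaussSum_mul_self (ψ₀ : AddChar (ZMod 2) ℂ) (ω : MulChar F16 ℂ) :
    gaussSum (ω * ω) (psiTilde ψ₀) = gaussSum ω (psiTilde ψ₀) := by
  unfold gaussSum
  have h1 : ∀ y, psiTilde ψ₀ (frob y) = psiTilde ψ₀ y := by
    intro y
    rw [psiTilde_apply, psiTilde_apply]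
    congr 1
    exact Algebra.trace_eq_of_algEquiv frob y
  rw [← Fintype.sum_equiv frob.toEquiv (fun y => ω (frob y) * psiTilde ψ₀ (frob y))
    (fun x => ω x * psiTilde ψ₀ x) (fun y => rfl)]
  refine Finset.sum_congr rfl fun y _ => ?_
  rw [h1 y, frob_apply, map_pow, MulChar.coeToFun_mul, Pi.mul_apply, sq]

/-- `𝔤(ω^{2^j}, ψ̃) = 𝔤(ω, ψ̃)`. -/
theorem gaussSum_pow_two_pow (ψ₀ : AddChar (ZMod 2) ℂ) (ω : MulChar F16 ℂ) (j : ℕ) :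
    gaussSum (ω ^ (2 ^ j)) (psiTilde ψ₀) = gaussSum ω (psiTilde ψ₀) := by
  induction j with
  | zero => rw [pow_zero, pow_one]
  | succ j ih => rw [pow_succ, pow_mul, sq, gaussSum_mul_self, ih]

/-- **All non-trivial characters of order dividing `5` have the same Gauss sum**: `2` generates `(ℤ/5)^×`, so
`ω^k = ω^{2^j}` for `5 ∤ k`. -/
theorem gaussSum_pow_eq_of_order_five (ψ₀ : AddChar (ZMod 2) ℂ) (ω : MulChar F16 ℂ) (hω5 : ω ^ 5 = 1) (k : ℕ)
    (hk : ¬ 5 ∣ k) : gaussSum (ω ^ k) (psiTilde ψ₀) = gaussSum ω (psiTilde ψ₀) := by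
  rw [pow_eq_pow_mod k hω5]
  have hlt : k % 5 < 5 := Nat.mod_lt k (by norm_num)
  have hne : k % 5 ≠ 0 := fun h => hk (Nat.dvd_of_mod_eq_zero h)
  interval_cases h : k % 5
  · exact absurd rfl hne
  · rw [pow_one]
  · exact gaussSum_pow_two_pow ψ₀ ω 1
  · have : ω ^ 3 = ω ^ (2 ^ 3) := by
      rw [show (2 : ℕ) ^ 3 = 3 + 5 by norm_num, pow_add, hω5, mul_one]
    rw [this]; exact gaussSum_pow_two_pow ψ₀ ω 3
  · exact gaussSum_pow_two_pow ψ₀ ω 2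

/-- **(E3) at `𝔮 | 2` for four conjugate-dual tame lines in the Frobenius orbit of one `ω`**: with
`ω_j = ⟨ω^{k_j}, π_j⟩`, `ω⁵ = 1`, `ω ≠ 1`, `5 ∤ k_j` (so every `ω^{k_j}` is non-trivial and conjugate-dual), all
four Gauss sums equal `𝔤(ω)` and `ε(½, ω_j) = ω_j(ϖ)^n · 𝔤(ω)/4`; hence `ε₀ε₁ = ε₂ε₃` iff `(π₀π₁)^n = (π₂π₃)^n`,
which the `ϖ`-part of N2 gives. -/
theorem E3_inert_of_N2 (ψ₀ : AddChar (ZMod 2) ℂ) (n : ℕ) (ω : MulChar F16 ℂ) (hω5 : ω ^ 5 = 1)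
    (k : Fin 4 → ℕ) (hk : ∀ j, ¬ 5 ∣ k j) (π : Fin 4 → ℂ) (hN2 : π 0 * π 1 = π 2 * π 3) :
    LocalChar.eps (1 / 4) n (⟨ω ^ k 0, π 0⟩ : LocalChar F16) (psiTilde ψ₀) *
        LocalChar.eps (1 / 4) n (⟨ω ^ k 1, π 1⟩ : LocalChar F16) (psiTilde ψ₀) =
      LocalChar.eps (1 / 4) n (⟨ω ^ k 2, π 2⟩ : LocalChar F16) (psiTilde ψ₀) *
        LocalChar.eps (1 / 4) n (⟨ω ^ k 3, π 3⟩ : LocalChar F16) (psiTilde ψ₀) := by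
  -- every `ω^{k_j}` is conjugate-dual: `(ω^k)(x)^5 = ((ω^5)(x))^k = 1`
  have hcd : ∀ j, ∀ x, (ω ^ k j) (conj x) = (ω ^ k j)⁻¹ x := by
    intro j
    rw [conjDual_iff_pow_five]
    intro x hx
    have hkj : k j ≠ 0 := fun h => hk j (h ▸ dvd_zero 5)
    rw [MulChar.pow_apply' ω hkj x, ← pow_mul, mul_comm, pow_mul, ← MulChar.pow_apply' ω (by norm_num) x, hω5,
      MulChar.one_apply (isUnit_iff_ne_zero.2 hx), one_pow]
  -- the common value of the four ε-factors
  have hval : ∀ j, LocalChar.eps (1 / 4) n (⟨ω ^ k j, π j⟩ : LocalChar F16) (psiTilde ψ₀) =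
      π j ^ n * (1 / 4) * gaussSum ω (psiTilde ψ₀) := by
    intro j
    unfold LocalChar.eps LocalChar.gauss
    rw [gaussSum_inv_eq_of_conjDual ψ₀ _ (hcd j), gaussSum_pow_eq_of_order_five ψ₀ ω hω5 (k j) (hk j)]
  rw [hval 0, hval 1, hval 2, hval 3]
  calc π 0 ^ n * (1 / 4) * gaussSum ω (psiTilde ψ₀) * (π 1 ^ n * (1 / 4) * gaussSum ω (psiTilde ψ₀)) =
      (π 0 * π 1) ^ n * ((1 / 4) * gaussSum ω (psiTilde ψ₀)) ^ 2 := by ring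
    _ = (π 2 * π 3) ^ n * ((1 / 4) * gaussSum ω (psiTilde ψ₀)) ^ 2 := by rw [hN2]
    _ = _ := by ring

/-! ### The two classes of the route at `𝔮`: conjugate-symplectic (`ω(ϖ) = −1`) and conjugate-orthogonal (`ω(ϖ) = 1`) -/

/-- **Conjugate-symplectic tame characters at `𝔮`** (`ω|_{k_v^×} = ω_{K_v/k_v}`, the unramified quadratic
character: `−1` on the uniformiser `ϖ ∈ k_v`, `1` on the units — so on the model `ω(ϖ) = −1`; the unit part is
automatically trivial on `𝔽₄^×`): `ε(½, ω, ψ_δ) = ±(−1)^n`. -/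
theorem eps_conjSymplectic_inert (ψ₀ : AddChar (ZMod 2) ℂ) (h₀ : ψ₀ 1 ≠ 1) (n : ℕ) (ω : LocalChar F16)
    (hω : ω.unit ≠ 1) (hσ : ∀ x, ω.unit (conj x) = ω.unit⁻¹ x) (hπ : ω.piVal = -1) :
    LocalChar.eps (1 / 4) n ω (psiTilde ψ₀) = (-1) ^ n ∨ LocalChar.eps (1 / 4) n ω (psiTilde ψ₀) = -(-1) ^ n := by
  have h := eps_eq_pm_piVal_pow ψ₀ h₀ n ω hω hσ
  rwa [hπ] at h

/-- **Conjugate-orthogonal tame characters at `𝔮`** (`ω|_{k_v^×} = 1`, so `ω(ϖ) = 1`): `ε(½, ω, ψ_δ) = ±1`. -/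
theorem eps_conjOrthogonal_inert (ψ₀ : AddChar (ZMod 2) ℂ) (h₀ : ψ₀ 1 ≠ 1) (n : ℕ) (ω : LocalChar F16)
    (hω : ω.unit ≠ 1) (hσ : ∀ x, ω.unit (conj x) = ω.unit⁻¹ x) (hπ : ω.piVal = 1) :
    LocalChar.eps (1 / 4) n ω (psiTilde ψ₀) = 1 ∨ LocalChar.eps (1 / 4) n ω (psiTilde ψ₀) = -1 := by
  have h := eps_eq_pm_piVal_pow ψ₀ h₀ n ω hω hσ
  rwa [hπ, one_pow] at h

end InertModel

end Summit.Ventures.HodgeRepro.PeriodCloser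

end
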